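import Summits.Parity.GeneralizedHardyLittlewood.Theorems.GreenTaoLevelTwoGITwoCyclicInverseQuadruples
import Mathlib.Analysis.SpecialFunctions.Complex.CircleAddChar
import Mathlib.Analysis.SpecialFunctions.Trigonometric.Basic
import HarnessLib

/-!
# Route `GreenTaoLevelTwo`, crux `GITwo` (stmt-Parity-21275), line `birth`, stub `stub_cyclicInverse`:
# Bogolyubov's lemma in `ℤ/Mℤ` (counting form)

Third helper file toward the XL stub `stub_cyclicInverse` (B. Green, T. Tao, *An inverse theorem
for the Gowers `U³(G)` norm*, PEMS 51 (2008), Thm. 12.8 = arXiv:math/0503014, Thm. 10.8).  After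
Gowers' argument (files `…CyclicInverseDerivatives`, `…CyclicInverseQuadruples`) the printed proof
runs through the Balog–Szemerédi–Gowers theorem, the Plünnecke–Ruzsa inequalities (Mathlib,
`Mathlib.Combinatorics.Additive.PluenneckeRuzsa`) and — in the model argument (arXiv Lemma 6.3,
"Bogolyubov lemma") and again in its local form on Bohr sets (arXiv Lemma 8.5, "local Bogolyubov
lemma") — **Bogolyubov's lemma**: if `A ⊆ G` has density `β` then `2A − 2A ⊇ B(S, ¼)` for the large
spectrum `S` of `1_A`, `|S| ≪ β^{-O(1)}`.  This def-free file lands the GLOBAL lemma over `ℤ/Mℤ` in the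
tree's vocabulary (`dftCoeff` of `LinearEquationsInPrimesFourierU2.lean`, `ZMod.stdAddChar`), in a
counting form with explicit constants (`β = #A/M`, `1_A = fun y => if y ∈ A then 1 else 0`):

* `sum_indicator_mul`, `dftCoeff_indicator_mul_conj_eq` — `M² |1̂_A(ξ)|² = ∑_{(a,c) ∈ A²} e((c−a)ξ/M)`;
* `card_quadruples_eq_sum_dft` — the convolution identity
  `#{((a,c),(b,d)) ∈ A²×A² : (a − c) + (b − d) = x} = M³ ∑_ξ |1̂_A(ξ)|⁴ e(xξ/M)`;
* `sum_norm_dftCoeff_indicator_sq` (Parseval, `= β`), `norm_dftCoeff_indicator_zero` (`= β`);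
* `card_largeSpec_mul_le` — the large spectrum `{ξ : |1̂_A(ξ)|² ≥ β³/4}` has `#S · β³/4 ≤ β`;
* `bogolyubov_count` — **Bogolyubov**: if `Re e(xξ/M) ≥ 0` for every `ξ ≠ 0` of the large spectrum,
  then `#{((a,c),(b,d)) ∈ A²×A² : (a − c) + (b − d) = x} ≥ ¾ β⁴ M³ = ¾ (#A)⁴/M`; hence
  `x ∈ (A − A) + (A − A)` (`exists_sub_add_sub_eq_of_re_nonneg`);
* `re_stdAddChar_nonneg_of_val` — the Bohr-set condition `‖y/M‖_{ℝ/ℤ} ≤ ¼` (as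
  `4·val y ≤ M ∨ 3M ≤ 4·val y`) gives `Re e(y/M) ≥ 0`, so `B(S, ¼) ⊆ 2A − 2A` as printed.

References: [GreenTao2008U3Inverse] arXiv:math/0503014, Lemma 6.3 and its proof; N. N. Bogolyubov,
*Sur quelques propriétés arithmétiques des presque-périodes*, Ann. Chaire Math. Phys. Kiev 4 (1939).
-/

noncomputable section

open Finset ZMod
open scoped BigOperators ComplexConjugate

namespace Summit.Parity.GeneralizedHardyLittlewood.GreenTaoLevelTwoGITwoCyclicInverse

open Literature.NumberTheory.Sieve

variable {M : ℕ} [NeZero M]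

/-! ### The Fourier transform of an indicator -/

/-- Summing against an indicator restricts the sum: `∑_y 1_A(y) g(y) = ∑_{y ∈ A} g(y)`. [folklore] -/
theorem sum_indicator_mul (A : Finset (ZMod M)) (g : ZMod M → ℂ) :
    ∑ y : ZMod M, (((if y ∈ A then (1 : ℝ) else 0 : ℝ)) : ℂ) * g y = ∑ y ∈ A, g y := by
  have h : ∀ y : ZMod M, (((if y ∈ A then (1 : ℝ) else 0 : ℝ)) : ℂ) * g y =
      if y ∈ A then g y else 0 := fun y => by
    split_ifs <;> simp
  simp_rw [h]
  rw [Finset.sum_ite_mem, Finset.univ_inter]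

/-- `M² · 1̂_A(ξ) · conj 1̂_A(ξ) = ∑_{(a,c) ∈ A × A} e((c − a)ξ/M)`. [folklore] -/
theorem dftCoeff_indicator_mul_conj_eq (A : Finset (ZMod M)) (ξ : ZMod M) :
    ((M : ℂ) * M) * (dftCoeff (fun y => if y ∈ A then (1 : ℝ) else 0) ξ *
        conj (dftCoeff (fun y => if y ∈ A then (1 : ℝ) else 0) ξ)) =
      ∑ p ∈ A ×ˢ A, (stdAddChar ((p.2 - p.1) * ξ) : ℂ) := by
  have hM : (M : ℂ) ≠ 0 := by exact_mod_cast NeZero.ne M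
  rw [dftCoeff_mul_conj, mul_div_cancel₀ _ (mul_ne_zero hM hM), Finset.sum_product]
  have h1 : ∀ x : ZMod M, (∑ y : ZMod M, (((if x ∈ A then (1 : ℝ) else 0 : ℝ)) : ℂ) *
      (((if y ∈ A then (1 : ℝ) else 0 : ℝ)) : ℂ) * stdAddChar ((y - x) * ξ)) =
      (((if x ∈ A then (1 : ℝ) else 0 : ℝ)) : ℂ) * ∑ y ∈ A, (stdAddChar ((y - x) * ξ) : ℂ) := by
    intro x
    rw [← sum_indicator_mul A, Finset.mul_sum]
    exact Finset.sum_congr rfl fun y _ => by ring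
  simp_rw [h1]
  rw [sum_indicator_mul A]

/-- **Parseval for an indicator**: `∑_ξ |1̂_A(ξ)|² = #A/M`. [folklore] -/
theorem sum_norm_dftCoeff_indicator_sq (A : Finset (ZMod M)) :
    ∑ ξ : ZMod M, ‖dftCoeff (fun y => if y ∈ A then (1 : ℝ) else 0) ξ‖ ^ 2 = (#A : ℝ) / M := by
  rw [sum_norm_dftCoeff_sq]
  congr 1
  have h : ∀ x : ZMod M, (if x ∈ A then (1 : ℝ) else 0) ^ 2 = if x ∈ A then (1 : ℝ) else 0 :=
    fun x => by split_ifs <;> norm_num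
  simp_rw [h]
  rw [Finset.sum_boole, Finset.filter_univ_mem]

/-- `1̂_A(0) = #A/M`. [folklore] -/
theorem dftCoeff_indicator_zero (A : Finset (ZMod M)) :
    dftCoeff (fun y => if y ∈ A then (1 : ℝ) else 0) 0 = (#A : ℂ) / M := by
  unfold dftCoeff
  rw [sum_indicator_mul A]
  congr 1
  simp

/-- `|1̂_A(0)|² = (#A/M)²`. [folklore] -/
theorem norm_dftCoeff_indicator_zero_sq (A : Finset (ZMod M)) :
    ‖dftCoeff (fun y => if y ∈ A then (1 : ℝ) else 0) 0‖ ^ 2 = ((#A : ℝ) / M) ^ 2 := by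
  rw [dftCoeff_indicator_zero, norm_div, Complex.norm_natCast, Complex.norm_natCast]

/-- **The large spectrum is small**: with `β = #A/M` and `S = {ξ : |1̂_A(ξ)|² ≥ β³/4}` one has
`#S · β³/4 ≤ β` (so `#S ≤ 4β⁻²`). [cite: GreenTao2008U3Inverse, Lemma 6.3 (proof)] -/
theorem card_largeSpec_mul_le (A : Finset (ZMod M)) (S : Finset (ZMod M))
    (hS : ∀ ξ ∈ S, ((#A : ℝ) / M) ^ 3 / 4 ≤
      ‖dftCoeff (fun y => if y ∈ A then (1 : ℝ) else 0) ξ‖ ^ 2) :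
    (#S : ℝ) * (((#A : ℝ) / M) ^ 3 / 4) ≤ (#A : ℝ) / M := by
  calc (#S : ℝ) * (((#A : ℝ) / M) ^ 3 / 4)
      = ∑ _ξ ∈ S, ((#A : ℝ) / M) ^ 3 / 4 := by rw [sum_const, nsmul_eq_mul]
    _ ≤ ∑ ξ ∈ S, ‖dftCoeff (fun y => if y ∈ A then (1 : ℝ) else 0) ξ‖ ^ 2 := sum_le_sum hS
    _ ≤ ∑ ξ : ZMod M, ‖dftCoeff (fun y => if y ∈ A then (1 : ℝ) else 0) ξ‖ ^ 2 :=
        sum_le_sum_of_subset_of_nonneg (subset_univ S) fun _ _ _ => by positivity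
    _ = (#A : ℝ) / M := sum_norm_dftCoeff_indicator_sq A

/-! ### The convolution identity -/

/-- **`1_A ∗ 1_A ∗ 1_{−A} ∗ 1_{−A}` via Fourier inversion**, counting form:
`#{((a,c),(b,d)) ∈ A²×A² : (a − c) + (b − d) = x} = M³ ∑_ξ |1̂_A(ξ)|⁴ e(xξ/M)`.
[cite: GreenTao2008U3Inverse, Lemma 6.3 (proof)] -/
theorem card_quadruples_eq_sum_dft (A : Finset (ZMod M)) (x : ZMod M) :
    ((#{q ∈ (A ×ˢ A) ×ˢ (A ×ˢ A) | q.1.1 - q.1.2 + (q.2.1 - q.2.2) = x} : ℕ) : ℂ) =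
      (M : ℂ) ^ 3 * ∑ ξ : ZMod M,
        (((‖dftCoeff (fun y => if y ∈ A then (1 : ℝ) else 0) ξ‖ ^ 2) ^ 2 : ℝ) : ℂ) *
          stdAddChar (x * ξ) := by
  have hM : (M : ℂ) ≠ 0 := by exact_mod_cast NeZero.ne M
  set z : ZMod M → ℂ := fun ξ => dftCoeff (fun y => if y ∈ A then (1 : ℝ) else 0) ξ with hz
  -- each summand, multiplied by `M⁴`, is a character sum over quadruples
  have key : ∀ ξ : ZMod M, (M : ℂ) ^ 4 * ((((‖z ξ‖ ^ 2) ^ 2 : ℝ) : ℂ) * stdAddChar (x * ξ)) =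
      ∑ q ∈ (A ×ˢ A) ×ˢ (A ×ˢ A),
        (stdAddChar (((q.1.2 - q.1.1) + (q.2.2 - q.2.1) + x) * ξ) : ℂ) := by
    intro ξ
    have h2 : (((‖z ξ‖ ^ 2) ^ 2 : ℝ) : ℂ) = (z ξ * conj (z ξ)) ^ 2 := by
      rw [← ofReal_norm_sq_eq_mul_conj]; push_cast; ring
    rw [h2, show (M : ℂ) ^ 4 * ((z ξ * conj (z ξ)) ^ 2 * stdAddChar (x * ξ)) =
      (((M : ℂ) * M) * (z ξ * conj (z ξ))) * (((M : ℂ) * M) * (z ξ * conj (z ξ))) *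
        stdAddChar (x * ξ) by ring]
    rw [hz, dftCoeff_indicator_mul_conj_eq, Finset.sum_mul_sum]
    simp_rw [Finset.sum_mul]
    rw [← Finset.sum_product']
    refine Finset.sum_congr rfl fun q _ => ?_
    rw [← AddChar.map_add_eq_mul, ← AddChar.map_add_eq_mul]
    congr 1
    ring
  -- sum over `ξ` and use orthogonality
  have hsum : (M : ℂ) ^ 4 * ∑ ξ : ZMod M, (((‖z ξ‖ ^ 2) ^ 2 : ℝ) : ℂ) * stdAddChar (x * ξ) =
      (M : ℂ) * #{q ∈ (A ×ˢ A) ×ˢ (A ×ˢ A) | q.1.1 - q.1.2 + (q.2.1 - q.2.2) = x} := by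
    have hfilter : ({q ∈ (A ×ˢ A) ×ˢ (A ×ˢ A) | q.1.2 - q.1.1 + (q.2.2 - q.2.1) + x = 0} : Finset _) =
        {q ∈ (A ×ˢ A) ×ˢ (A ×ˢ A) | q.1.1 - q.1.2 + (q.2.1 - q.2.2) = x} :=
      Finset.filter_congr fun q _ =>
        ⟨fun h => by linear_combination -h, fun h => by linear_combination -h⟩
    rw [Finset.mul_sum]
    simp_rw [key]
    rw [Finset.sum_comm]
    simp_rw [sum_stdAddChar_mul_eq]
    rw [← Finset.sum_filter, sum_const, nsmul_eq_mul, hfilter, mul_comm]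
  have h4 : (M : ℂ) ^ 4 = M * (M : ℂ) ^ 3 := by ring
  rw [h4, mul_assoc] at hsum
  exact (mul_left_cancel₀ hM hsum).symm

/-! ### Bogolyubov's lemma -/

/-- **Bogolyubov's lemma, counting form.** Let `A ⊆ ℤ/Mℤ`, `β = #A/M`, and let `x` be such that
`Re e(xξ/M) ≥ 0` for every nonzero `ξ` in the large spectrum `{ξ : |1̂_A(ξ)|² ≥ β³/4}`.  Then
`#{((a,c),(b,d)) ∈ A²×A² : (a − c) + (b − d) = x} ≥ ¾ (#A)⁴ / M`.
[cite: GreenTao2008U3Inverse, Lemma 6.3] -/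
theorem bogolyubov_count (A : Finset (ZMod M)) (x : ZMod M)
    (hx : ∀ ξ : ZMod M, ξ ≠ 0 →
      ((#A : ℝ) / M) ^ 3 / 4 ≤ ‖dftCoeff (fun y => if y ∈ A then (1 : ℝ) else 0) ξ‖ ^ 2 →
        0 ≤ (stdAddChar (x * ξ) : ℂ).re) :
    3 / 4 * (#A : ℝ) ^ 4 / M ≤
      #{q ∈ (A ×ˢ A) ×ˢ (A ×ˢ A) | q.1.1 - q.1.2 + (q.2.1 - q.2.2) = x} := by
  have hMpos : (0 : ℝ) < M := by exact_mod_cast Nat.pos_of_ne_zero (NeZero.ne M)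
  obtain ⟨w, hw⟩ : ∃ w : ZMod M → ℝ,
      ∀ ξ, w ξ = ‖dftCoeff (fun y => if y ∈ A then (1 : ℝ) else 0) ξ‖ ^ 2 := ⟨_, fun _ => rfl⟩
  set β : ℝ := (#A : ℝ) / M with hβ
  have hβ0 : 0 ≤ β := by positivity
  have hw0 : ∀ ξ, 0 ≤ w ξ := fun ξ => by rw [hw]; positivity
  -- the count as a real sum
  have hcount : (#{q ∈ (A ×ˢ A) ×ˢ (A ×ˢ A) | q.1.1 - q.1.2 + (q.2.1 - q.2.2) = x} : ℝ) =
      (M : ℝ) ^ 3 * ∑ ξ : ZMod M, w ξ ^ 2 * (stdAddChar (x * ξ) : ℂ).re := by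
    have h := congrArg Complex.re (card_quadruples_eq_sum_dft A x)
    rw [Complex.natCast_re] at h
    have h3 : ((M : ℂ) ^ 3) = (((M : ℝ) ^ 3 : ℝ) : ℂ) := by push_cast; ring
    rw [h, h3, Complex.re_ofReal_mul, Complex.re_sum]
    congr 1
    refine Finset.sum_congr rfl fun ξ _ => ?_
    rw [Complex.re_ofReal_mul, hw]
  -- termwise lower bound off `ξ = 0`
  have hterm : ∀ ξ : ZMod M, ξ ≠ 0 → -(β ^ 3 / 4 * w ξ) ≤ w ξ ^ 2 * (stdAddChar (x * ξ) : ℂ).re := by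
    intro ξ hξ
    rcases le_or_gt (β ^ 3 / 4) (w ξ) with hge | hlt
    · have : 0 ≤ w ξ ^ 2 * (stdAddChar (x * ξ) : ℂ).re :=
        mul_nonneg (sq_nonneg _) (hx ξ hξ (by rw [← hw]; exact hge))
      nlinarith [hw0 ξ, pow_nonneg hβ0 3]
    · have hre : -1 ≤ (stdAddChar (x * ξ) : ℂ).re := by
        have h1 := Complex.abs_re_le_norm (stdAddChar (x * ξ) : ℂ)
        rw [norm_stdAddChar] at h1
        exact neg_le_of_abs_le h1
      have h2 : w ξ ^ 2 ≤ β ^ 3 / 4 * w ξ := by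
        rw [sq]; exact mul_le_mul_of_nonneg_right hlt.le (hw0 ξ)
      nlinarith [hw0 ξ, sq_nonneg (w ξ)]
  -- the `ξ = 0` term
  have hzero : w 0 ^ 2 * (stdAddChar (x * 0) : ℂ).re = β ^ 4 := by
    rw [mul_zero, AddChar.map_zero_eq_one, Complex.one_re, mul_one, hw,
      norm_dftCoeff_indicator_zero_sq]
    ring
  -- summing
  have hsplit := Finset.add_sum_erase (univ : Finset (ZMod M))
    (fun ξ => w ξ ^ 2 * (stdAddChar (x * ξ) : ℂ).re) (mem_univ 0)
  have hrest : -(β ^ 3 / 4 * β) ≤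
      ∑ ξ ∈ (univ : Finset (ZMod M)).erase 0, w ξ ^ 2 * (stdAddChar (x * ξ) : ℂ).re := by
    have h1 : ∑ ξ ∈ (univ : Finset (ZMod M)).erase 0, -(β ^ 3 / 4 * w ξ) ≤
        ∑ ξ ∈ (univ : Finset (ZMod M)).erase 0, w ξ ^ 2 * (stdAddChar (x * ξ) : ℂ).re :=
      sum_le_sum fun ξ hξ => hterm ξ (Finset.ne_of_mem_erase hξ)
    have h2 : ∑ ξ ∈ (univ : Finset (ZMod M)).erase 0, w ξ ≤ ∑ ξ : ZMod M, w ξ :=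
      sum_le_sum_of_subset_of_nonneg (erase_subset _ _) fun ξ _ _ => hw0 ξ
    have h3 : ∑ ξ : ZMod M, w ξ = β := by
      simp_rw [hw]; exact sum_norm_dftCoeff_indicator_sq A
    rw [sum_neg_distrib, ← mul_sum] at h1
    have h4 : β ^ 3 / 4 * ∑ ξ ∈ (univ : Finset (ZMod M)).erase 0, w ξ ≤ β ^ 3 / 4 * β :=
      mul_le_mul_of_nonneg_left (h2.trans h3.le) (by positivity)
    linarith
  have htotal : 3 / 4 * β ^ 4 ≤ ∑ ξ : ZMod M, w ξ ^ 2 * (stdAddChar (x * ξ) : ℂ).re := by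
    rw [← hsplit, hzero]
    nlinarith [hrest]
  rw [hcount]
  calc 3 / 4 * (#A : ℝ) ^ 4 / M = (M : ℝ) ^ 3 * (3 / 4 * β ^ 4) := by
        rw [hβ]; field_simp
    _ ≤ (M : ℝ) ^ 3 * ∑ ξ : ZMod M, w ξ ^ 2 * (stdAddChar (x * ξ) : ℂ).re := by gcongr

/-- **Bogolyubov's lemma** (`B(S,¼) ⊆ 2A − 2A`, spectral form): under the hypothesis of
`bogolyubov_count`, a nonempty `A` represents `x` as `(a − c) + (b − d)` with `a, b, c, d ∈ A`.
[cite: GreenTao2008U3Inverse, Lemma 6.3] -/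
theorem exists_sub_add_sub_eq_of_re_nonneg {A : Finset (ZMod M)} (hA : A.Nonempty) (x : ZMod M)
    (hx : ∀ ξ : ZMod M, ξ ≠ 0 →
      ((#A : ℝ) / M) ^ 3 / 4 ≤ ‖dftCoeff (fun y => if y ∈ A then (1 : ℝ) else 0) ξ‖ ^ 2 →
        0 ≤ (stdAddChar (x * ξ) : ℂ).re) :
    ∃ a ∈ A, ∃ c ∈ A, ∃ b ∈ A, ∃ d ∈ A, a - c + (b - d) = x := by
  have hMpos : (0 : ℝ) < M := by exact_mod_cast Nat.pos_of_ne_zero (NeZero.ne M)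
  have hApos : (0 : ℝ) < #A := by exact_mod_cast hA.card_pos
  have h := bogolyubov_count A x hx
  have hpos : (0 : ℝ) < #{q ∈ (A ×ˢ A) ×ˢ (A ×ˢ A) | q.1.1 - q.1.2 + (q.2.1 - q.2.2) = x} :=
    lt_of_lt_of_le (by positivity) h
  have hne : ({q ∈ (A ×ˢ A) ×ˢ (A ×ˢ A) | q.1.1 - q.1.2 + (q.2.1 - q.2.2) = x} : Finset _).Nonempty := by
    rw [← Finset.card_pos]; exact_mod_cast hpos
  obtain ⟨q, hq⟩ := hne
  rw [mem_filter, mem_product, mem_product, mem_product] at hq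
  exact ⟨q.1.1, hq.1.1.1, q.1.2, hq.1.1.2, q.2.1, hq.1.2.1, q.2.2, hq.1.2.2, hq.2⟩

/-! ### The Bohr-set condition -/

/-- The Bohr-set condition at radius `¼` implies the spectral hypothesis: if the residue `y` has
`‖y/M‖_{ℝ/ℤ} ≤ ¼`, i.e. `4·val(y) ≤ M` or `4·val(y) ≥ 3M`, then `Re e(y/M) = cos(2π val(y)/M) ≥ 0`.
[cite: GreenTao2008U3Inverse, Lemma 6.3 (last step of the proof)] -/
theorem re_stdAddChar_nonneg_of_val (y : ZMod M) (hy : 4 * y.val ≤ M ∨ 3 * M ≤ 4 * y.val) :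
    0 ≤ (stdAddChar y : ℂ).re := by
  have hMpos : (0 : ℝ) < M := by exact_mod_cast Nat.pos_of_ne_zero (NeZero.ne M)
  have hval : (y.val : ℝ) < M := by exact_mod_cast ZMod.val_lt y
  rw [stdAddChar_apply, toCircle_apply]
  have harg : (2 * (Real.pi : ℂ) * Complex.I * (y.val : ℂ) / (M : ℂ)) =
      ((2 * Real.pi * y.val / M : ℝ) : ℂ) * Complex.I := by
    push_cast
    ring
  rw [harg, Complex.exp_ofReal_mul_I_re]
  rcases hy with h | h
  · have h' : (4 : ℝ) * y.val ≤ M := by exact_mod_cast h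
    apply Real.cos_nonneg_of_mem_Icc
    constructor
    · have : (0 : ℝ) ≤ 2 * Real.pi * y.val / M := by positivity
      linarith [Real.pi_pos]
    · rw [div_le_iff₀ hMpos]
      nlinarith [Real.pi_pos]
  · have h' : (3 : ℝ) * M ≤ 4 * y.val := by exact_mod_cast h
    rw [← Real.cos_sub_two_pi]
    apply Real.cos_nonneg_of_mem_Icc
    constructor
    · rw [le_sub_iff_add_le, le_div_iff₀ hMpos]
      nlinarith [Real.pi_pos]
    · rw [sub_le_iff_le_add, div_le_iff₀ hMpos]
      nlinarith [Real.pi_pos]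

end Summit.Parity.GeneralizedHardyLittlewood.GreenTaoLevelTwoGITwoCyclicInverse
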